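import Mathlib
import Literature.NumberTheory.Sieve.Maynard2016Lemma7Halves
import Literature.NumberTheory.Sieve.Maynard2016Lemma7MainSum
import Literature.NumberTheory.Sieve.Maynard2016RmLower
import Literature.NumberTheory.Sieve.Maynard2016IntervalPrimesUpper
import Literature.NumberTheory.Sieve.Maynard2016Lemma7SingRatio
import HarnessLib

/-!
# Maynard 2016, Lemma 7 — assembly of the per-tuple form from two engine facts

[cite: Maynard2016LargeGaps, Lemma 7 (proof, displays (6.26)–(6.34))]

`Lemma7Tuple` (the per-tuple Lemma 7 feeding Theorem 1 through `theorem1_of_lemma7Tuple`) is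
reduced here to two named facts about the **`(k−1)`-slot `φ`-weighted lcm engine of Lemma 7**
(the engine of Lemma 6 with the slot `i` frozen, cf. `ofReal_solvSum_eq_coupledLcmSumW`):

* `Lemma7MainLower` — the main term: the solvable-tuple sum `S_i` of `lemma7_errorHalf` satisfies
  `(log x)^{k−1}(log y)^{k−1} S_i ≥ (J₁^{(i)} J₂ − η) · 𝔖_small^{(k−1)} · N⁷` for every `η > 0` and
  all large `x`, where `N⁷ = nuProd7` is the `ν`-product of the engine ((6.29)–(6.33));
* `Lemma7ClassMoment` — the congruence-class moment: the `V_q`-correction of the norm factor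
  (`lemma7_normHalf`, display (6.24)–(6.25) in corrected form) is
  `≤ η · #{primes of 𝓘_m} · 𝔖_small^{(k−1)} N⁷/((log x)^{k−1}(log y)^{k−1}) + O_A(x/(log x)^A)`
  (the mass of `Σ_q T(q)` in a class `q ≡ c (mod p)`, `w < p ≤ y`, is `O(k²/p)` of the total).

Given these, `lemma7Tuple_of_parts` proves `Lemma7Tuple` with the ABSOLUTE constant
`c = e^{−5}/100`: the `Π_m`-loss of the norm factor against the `|𝓡_m|`-gain of Lemma 3 is the
prime-by-prime ratio of `eventually_lemma7_singRatio` (display (6.34)), the number of primes of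
`𝓘_m` comes from `eventually_card_intervalPrimes_ge`, `|𝓡_m|` from Lemma 3 (PROVED,
`lemma3_holds`), and the error terms `O(x/(log x)^{2k+4})` are absorbed using
`|𝓘_m| ≥ δ|𝓡_m| log x ≥ x/(log x)^4`.
-/

open Filter Finset Real Topology

namespace Literature.NumberTheory.Sieve

namespace Maynard2016

open LcmEuler

/-! ### The quantities of the Lemma-7 engine -/

/-- The bad primes of the Lemma-7 engine at `(m, p₀, i)`: the prime factors of `m` and of
`∏_{l ≠ j} |m p₀ (h_l − h_j) + (h_j − h_i)|` (outside these, and outside `p ≤ w`, the coupling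
sets `couplingSet7` are empty and `p ∤ m`). [cite: Maynard2016LargeGaps, Lemma 7 (proof, display (6.29))] -/
noncomputable def badPrimes7 (k x m p₀ : ℕ) (i : Fin k) : Finset ℕ :=
  m.primeFactors ∪
    (∏ jl ∈ (Finset.univ : Finset (Fin k × Fin k)).filter (fun jl => jl.2 ≠ jl.1),
      ((m : ℤ) * p₀ * ((hTuple k x jl.2 : ℤ) - hTuple k x jl.1) +
        ((hTuple k x jl.1 : ℤ) - hTuple k x i)).natAbs).primeFactors

/-- `N⁷ = ∏_{p bad, p ∤ P_w} (1 + ν_p/p)`, the `ν`-product of the `(k−1)`-slot Lemma-7 engine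
(`ν_p = k − 1` if `p ∣ m`, else the number of coupled pairs `#M_p`), as a real number; it is the
real part of `nuProd (Pw x) m (restrictPairs i i (couplingSet7 k x m p₀ i)) (badPrimes7 k x m p₀ i)`.
[cite: Maynard2016LargeGaps, Lemma 7 (proof, displays (6.31)–(6.33))] -/
noncomputable def nuProd7 (k x m p₀ : ℕ) (i : Fin k) : ℝ :=
  ∏ p ∈ (badPrimes7 k x m p₀ i).filter (fun p => p.Prime ∧ ¬ p ∣ Pw x),
    (1 + (coupledNu m (restrictPairs i i (couplingSet7 k x m p₀ i)) p : ℝ) / p)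

/-- `N⁷ ≥ 1`. [cite: Maynard2016LargeGaps, Lemma 7 (proof, display (6.33))] -/
theorem one_le_nuProd7 (k x m p₀ : ℕ) (i : Fin k) : 1 ≤ nuProd7 k x m p₀ i := by
  unfold nuProd7
  calc (1 : ℝ) = ∏ p ∈ (badPrimes7 k x m p₀ i).filter (fun p => p.Prime ∧ ¬ p ∣ Pw x), (1 : ℝ) := by
        simp
    _ ≤ _ := Finset.prod_le_prod (fun _ _ => zero_le_one) fun p _ => by
        have : (0 : ℝ) ≤ (coupledNu m (restrictPairs i i (couplingSet7 k x m p₀ i)) p : ℝ) / p := by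
          positivity
        linarith

/-- The number of free slots of the Lemma-7 engine is `k − 1`. [folklore] -/
private theorem card_slots_ne (k : ℕ) (i : Fin k) : Fintype.card {l : Fin k // l ≠ i} = k - 1 := by
  rw [Fintype.card_subtype, Finset.filter_ne', Finset.card_erase_of_mem (Finset.mem_univ i),
    Finset.card_univ, Fintype.card_fin]

/-- `N⁷ ≥ ∏_{w < p ≤ y, p ∣ m} (1 + (k−1)/p)` (`m ≥ 1`): the primes of `m` in `(w, y]` are bad,
do not divide `P_w`, and carry `ν_p = k − 1`; all other factors are `≥ 1`.
[cite: Maynard2016LargeGaps, Lemma 7 (proof, display (6.34))] -/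
theorem prod_mid_dvd_le_nuProd7 (k : ℕ) (ε : ℝ) (x : ℕ) {m : ℕ} (hm : 1 ≤ m) (p₀ : ℕ)
    (i : Fin k) :
    ∏ p ∈ (midPrimes ε x).filter (fun p => p ∣ m), (1 + ((k - 1 : ℕ) : ℝ) / p) ≤
      nuProd7 k x m p₀ i := by
  classical
  set S := (midPrimes ε x).filter (fun p => p ∣ m) with hS
  set T := (badPrimes7 k x m p₀ i).filter (fun p => p.Prime ∧ ¬ p ∣ Pw x) with hT
  set f : ℕ → ℝ := fun p =>
    1 + (coupledNu m (restrictPairs i i (couplingSet7 k x m p₀ i)) p : ℝ) / p with hf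
  have hST : S ⊆ T := by
    intro p hp
    obtain ⟨hpmid, hpm⟩ := Finset.mem_filter.1 hp
    obtain ⟨hpp, hpW⟩ := not_dvd_Pw_of_mem_midPrimes hpmid
    refine Finset.mem_filter.2 ⟨?_, hpp, hpW⟩
    exact Finset.mem_union_left _ (Nat.mem_primeFactors.2 ⟨hpp, hpm, by omega⟩)
  have hfS : ∀ p ∈ S, (1 + ((k - 1 : ℕ) : ℝ) / p) = f p := fun p hp => by
    have hpm : p ∣ m := (Finset.mem_filter.1 hp).2
    simp only [hf, coupledNu, if_pos hpm, card_slots_ne]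
  have hf1 : ∀ p ∈ T, 1 ≤ f p := fun p _ => by
    have : (0 : ℝ) ≤ (coupledNu m (restrictPairs i i (couplingSet7 k x m p₀ i)) p : ℝ) / p := by
      positivity
    simp only [hf]; linarith
  have hf0 : ∀ p ∈ T, 0 ≤ f p := fun p hp => le_trans zero_le_one (hf1 p hp)
  rw [Finset.prod_congr rfl hfS, nuProd7, ← hT]
  change ∏ p ∈ S, f p ≤ ∏ p ∈ T, f p
  rw [← Finset.prod_sdiff hST]
  have h1 : 1 ≤ ∏ p ∈ T \ S, f p := by
    calc (1 : ℝ) = ∏ p ∈ T \ S, (1 : ℝ) := by simp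
      _ ≤ _ := Finset.prod_le_prod (fun _ _ => zero_le_one)
          fun p hp => hf1 p (Finset.mem_sdiff.1 hp).1
  have h0 : 0 ≤ ∏ p ∈ S, f p := Finset.prod_nonneg fun p hp => hf0 p (hST hp)
  exact le_mul_of_one_le_left h0 h1

/-- The congruence-class correction of the norm factor (`lemma7_normHalf`):
`Σ_{(a,b)} Σ_{w<p≤y, p∤m} p⁻¹ Σ_{q ∈ 𝓘 : p ∣ m q (h_b−h_a) − 1} T(q)`,
`T(q) = (Σ_{d,e} λ_{d,e})²` at `n = p₀ − h_i q`. [cite: Maynard2016LargeGaps, Lemma 7 (proof, displays (6.24)–(6.25))] -/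
noncomputable def classCorr {k J : ℕ} (cj : Fin J → ℝ) (Fd : Fin k → Fin J → ℝ → ℝ) (G : ℝ → ℝ) (ε : ℝ)
    (x m p₀ : ℕ) (i : Fin k) (A' B' : ℝ) : ℝ :=
  ∑ ab : Fin k × Fin k, ∑ p ∈ (midPrimes ε x).filter (fun p => ¬ p ∣ m),
    (1 : ℝ) / p *
      ∑ q ∈ (intervalPrimes A' B').filter (fun q : ℕ =>
        (p : ℤ) ∣ (m : ℤ) * q * ((hTuple k x ab.2 : ℤ) - hTuple k x ab.1) - 1),
        divSum cj Fd G ε x m q (p₀ - hTuple k x i * q) ^ 2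

/-! ### The two engine facts -/

/-- **Lemma 7, main term of the `(k−1)`-slot engine** ((6.29)–(6.33) at the frozen slot `i`):
for `k ≥ 2`, sieve data, `0 < ε ≤ 1/2`, `η > 0` and all large `x`: for `1 ≤ m ≤ x`, primes
`x < p₀ ≤ x²` with `(m p₀ − 1, P_y) = 1`, and every `i`,
`(J₁^{(i)} J₂ − η) · 𝔖_small^{(k−1)}(x) · N⁷ ≤ (log x)^{k−1} (log y)^{k−1} · S_i`,
where `S_i = solvSum` is the solvable-tuple sum `Σ λλ'/φ(r)` of `lemma7_errorHalf`
(`= Σ_{j,j'} c_j c_{j'} F_{i,j}(0) F_{i,j'}(0) G(0)² · coupledLcmSumW`, `ofReal_solvSum_eq_coupledLcmSumW`).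
Route: the Lemma-6 engine files (`BadPrimes`/`NuProd`/`CubeEstimate`/`PairBound`/`MainTermProof`)
ported to the index type `{l // l ≠ i}`, weight `phiInv`, bad modulus `m · ∏|m p₀(h_l−h_j)+(h_j−h_i)|`.
[cite: Maynard2016LargeGaps, Lemma 7 (proof, displays (6.29)–(6.33))] -/
def Lemma7MainLower : Prop :=
  ∀ (k J : ℕ) (cj : Fin J → ℝ) (Fd : Fin k → Fin J → ℝ → ℝ) (G : ℝ → ℝ), 2 ≤ k →
    IsSieveData k J cj Fd G → ∀ ε : ℝ, 0 < ε → ε ≤ 1 / 2 → ∀ η : ℝ, 0 < η →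
      ∀ᶠ x : ℕ in atTop, ∀ m : ℕ, 1 ≤ m → m ≤ x → ∀ p₀ : ℕ, p₀.Prime → x < p₀ →
        (p₀ : ℝ) ≤ (x : ℝ) ^ 2 → Nat.Coprime (m * p₀ - 1) (primorial ⌊y ε x⌋₊) → ∀ i : Fin k,
          (J1 cj Fd i * J2 k G - η) * (singSmall (k - 1) x * nuProd7 k x m p₀ i) ≤
            (Real.log x) ^ (k - 1) * (Real.log (y ε x)) ^ (k - 1) * solvSum cj Fd G ε x m p₀ i

/-- **Lemma 7, congruence-class moment of the main sum** (the step behind (6.24)–(6.25)):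
for `k ≥ 2`, sieve data, `0 < ε ≤ 1/2`, `A > 0`, `η > 0` there is `C` with, for all large `x`,
all `1 ≤ m ≤ x`, `x/2 ≤ A' ≤ B' ≤ x`, primes `x < p₀ ≤ x²` with `(m p₀ − 1, P_y) = 1`, and every
`i` with `h_i x < p₀`:
`classCorr ≤ η · #{q prime ∈ [A',B']} · 𝔖_small^{(k−1)} N⁷ / ((log x)^{k−1}(log y)^{k−1}) + C x/(log x)^A`.
Route: for each `w < p ≤ y`, `p ∤ m`, and pair `a ≠ b` the class `q ≡ (mΔ_{ab})⁻¹ (mod p)` receives,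
tuple by tuple, the fraction `[p∤r]/(p−1) + [p∣r][occupied slots ⊆ (J_c, L_c)]` of the main term;
the slot-masked kernels factor as `K · K_p^{mask}/K_p` with `|K_p^{mask}/K_p − [mask = ∅]| ≪ k²/p`,
so the class mass is `O(k²/p)` of the total, and `Σ_{p>w} k²/p² → 0`; the error terms are
Bombieri–Vinogradov with the extra prime `p ≤ y = x^{o(1)}` in the modulus.
[cite: Maynard2016LargeGaps, Lemma 7 (proof, displays (6.24)–(6.28))] -/
def Lemma7ClassMoment : Prop :=
  ∀ (k J : ℕ) (cj : Fin J → ℝ) (Fd : Fin k → Fin J → ℝ → ℝ) (G : ℝ → ℝ), 2 ≤ k →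
    IsSieveData k J cj Fd G → ∀ ε : ℝ, 0 < ε → ε ≤ 1 / 2 → ∀ A : ℝ, 0 < A → ∀ η : ℝ, 0 < η →
      ∃ C : ℝ, ∀ᶠ x : ℕ in atTop, ∀ m : ℕ, 1 ≤ m → m ≤ x → ∀ A' B' : ℝ, (x : ℝ) / 2 ≤ A' →
        A' ≤ B' → B' ≤ x → ∀ p₀ : ℕ, p₀.Prime → x < p₀ → (p₀ : ℝ) ≤ (x : ℝ) ^ 2 →
          Nat.Coprime (m * p₀ - 1) (primorial ⌊y ε x⌋₊) → ∀ i : Fin k,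
            (hTuple k x i : ℝ) * x < p₀ →
              classCorr cj Fd G ε x m p₀ i A' B' ≤
                η * ((intervalPrimes A' B').card : ℝ) * (singSmall (k - 1) x * nuProd7 k x m p₀ i) /
                    ((Real.log x) ^ (k - 1) * (Real.log (y ε x)) ^ (k - 1)) +
                  C * x / Real.log x ^ A

/-! ### Real-inequality cores -/

/-- `K e^{−√t} ≤ 1/2` once `t ≥ (log 2K)²` (`K > 0`). [folklore] -/
private theorem maynard7_K_mul_exp_neg_sqrt_le {K t : ℝ} (hK : 0 < K)
    (ht : Real.log (2 * K) ^ 2 ≤ t) : K * Real.exp (-t ^ ((1 : ℝ) / 2)) ≤ 1 / 2 := by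
  have hs : t ^ ((1 : ℝ) / 2) = Real.sqrt t := (Real.sqrt_eq_rpow t).symm
  rw [hs]
  rcases le_or_gt (Real.log (2 * K)) 0 with h | h
  · have h2K : 2 * K ≤ 1 := by
      by_contra hlt
      exact absurd (Real.log_pos (not_le.1 hlt)) (not_lt.2 h)
    have : Real.exp (-Real.sqrt t) ≤ 1 := by
      rw [Real.exp_le_one_iff]; linarith [Real.sqrt_nonneg t]
    nlinarith
  · have h1 : Real.log (2 * K) ≤ Real.sqrt t := Real.le_sqrt_of_sq_le ht
    have h2 : Real.exp (-Real.sqrt t) ≤ Real.exp (-Real.log (2 * K)) :=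
      Real.exp_le_exp.2 (by linarith)
    have h3 : Real.exp (-Real.log (2 * K)) = (2 * K)⁻¹ := by
      rw [Real.exp_neg, Real.exp_log (by linarith)]
    rw [h3] at h2
    calc K * Real.exp (-Real.sqrt t) ≤ K * (2 * K)⁻¹ := mul_le_mul_of_nonneg_left h2 hK.le
      _ = 1 / 2 := by field_simp

/-- `𝔖_small^{(j)}(x) ≥ 1`. [cite: Maynard2016LargeGaps, §6 display (6.20)] -/
theorem one_le_singSmall7 (j x : ℕ) : 1 ≤ singSmall j x := by
  unfold singSmall
  calc (1 : ℝ) = ∏ p ∈ (Finset.Iic ⌊wFun x⌋₊).filter Nat.Prime, (1 : ℝ) := by simp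
    _ ≤ _ := Finset.prod_le_prod (fun _ _ => zero_le_one) fun p hp => by
        have h2 : (2 : ℝ) ≤ p := by exact_mod_cast (Finset.mem_filter.1 hp).2.two_le
        have hq0 : 0 < 1 - 1 / (p : ℝ) := by
          have : 1 / (p : ℝ) ≤ 1 / 2 := by
            rw [div_le_div_iff₀ (by linarith) (by norm_num)]; linarith
          linarith
        have hq1 : 1 - 1 / (p : ℝ) ≤ 1 := by
          have : 0 ≤ 1 / (p : ℝ) := by positivity
          linarith
        exact one_le_inv_iff₀.2 ⟨pow_pos hq0 _, pow_le_one₀ hq0.le hq1⟩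

set_option maxHeartbeats 400000 in
/-- The real-inequality core of the assembly of Lemma 7, first half: the main term minus the
class-moment correction is `≥ J (B−A) sc/(8 log x)`. [folklore] -/
private theorem maynard7_core_main {j : ℕ} {L Ly sS' N T Co nI S BA J C₁ C₂ x : ℝ}
    (hL : 4 ≤ L) (hLy1 : 1 ≤ Ly) (hLyL : Ly ≤ L) (hsS' : 1 ≤ sS') (hN : 1 ≤ N) (hJ : 0 < J)
    (hx : 0 < x) (hBA : x / L ^ 4 ≤ BA)
    (hT : nI * S - C₁ * x / L ^ (2 * (j + 1) + 4) ≤ T)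
    (hS : (J - J / 4) * (sS' * N) ≤ L ^ j * Ly ^ j * S)
    (hCo : Co ≤ J / 4 * nI * (sS' * N) / (L ^ j * Ly ^ j) + C₂ * x / L ^ (2 * (j + 1) + 4))
    (hnI : (1 - 1 / 2) * (BA / L) ≤ nI)
    (hLC : 8 * (C₁ + C₂) ≤ J * L) :
    J * BA * (sS' * N / (L ^ j * Ly ^ j)) / (8 * L) ≤ T - Co := by
  have hL0 : 0 < L := by linarith
  have hLy0 : 0 < Ly := by linarith
  have hBA0 : 0 < BA := lt_of_lt_of_le (by positivity) hBA
  have hN0 : 0 < N := by linarith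
  have hsS'0 : 0 < sS' := by linarith
  set P : ℝ := L ^ j * Ly ^ j with hPdef
  have hP0 : 0 < P := by positivity
  set sc : ℝ := sS' * N / P with hscdef
  have hsc0 : 0 < sc := by positivity
  set A : ℝ := L ^ (2 * (j + 1) + 4) with hAdef
  have hA0 : 0 < A := by positivity
  -- (A) `S ≥ (3J/4) sc`
  have hSge : 3 * J / 4 * sc ≤ S := by
    have h1 : 3 * J / 4 * (sS' * N) ≤ P * S := by linarith
    rw [hscdef, ← mul_div_assoc, div_le_iff₀ hP0]
    linarith
  -- (B) `T − Co ≥ (J/2) nI sc − (C₁+C₂) x/A`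
  have hnI0 : 0 ≤ nI := le_trans (by positivity) hnI
  have hCo' : Co ≤ J / 4 * nI * sc + C₂ * x / A := by
    have e : J / 4 * nI * (sS' * N) / P = J / 4 * nI * sc := by rw [hscdef]; ring
    linarith
  have hB : J / 2 * nI * sc - (C₁ + C₂) * x / A ≤ T - Co := by
    have h1 : nI * (3 * J / 4 * sc) ≤ nI * S := mul_le_mul_of_nonneg_left hSge hnI0
    have e1 : (C₁ + C₂) * x / A = C₁ * x / A + C₂ * x / A := by ring
    have e2 : nI * (3 * J / 4 * sc) = 3 / 4 * (J * nI * sc) := by ring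
    have e3 : J / 2 * nI * sc = 1 / 2 * (J * nI * sc) := by ring
    have e4 : J / 4 * nI * sc = 1 / 4 * (J * nI * sc) := by ring
    linarith
  -- (C) `(J/2) nI sc ≥ J BA sc/(4L)`
  have hC : J * BA * sc / (4 * L) ≤ J / 2 * nI * sc := by
    have h1 := mul_le_mul_of_nonneg_left hnI (by positivity : (0 : ℝ) ≤ J / 2 * sc)
    have e1 : J / 2 * sc * ((1 - 1 / 2) * (BA / L)) = J * BA * sc / (4 * L) := by
      field_simp; ring
    have e2 : J / 2 * sc * nI = J / 2 * nI * sc := by ring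
    linarith
  -- (D) the error term: `(C₁+C₂) x/A ≤ J BA sc/(8L)`
  have hPle : P ≤ L ^ (2 * j) := by
    rw [hPdef, show 2 * j = j + j by ring, pow_add]
    exact mul_le_mul_of_nonneg_left (pow_le_pow_left₀ hLy0.le hLyL j) (by positivity)
  have hsc1 : 1 / L ^ (2 * j) ≤ sc := by
    rw [hscdef]
    calc 1 / L ^ (2 * j) ≤ 1 / P := one_div_le_one_div_of_le hP0 hPle
      _ ≤ sS' * N / P := by
          apply div_le_div_of_nonneg_right _ hP0.le
          nlinarith
  have hxA : x / L ^ (2 * j + 5) ≤ BA * sc / L := by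
    have e : x / L ^ (2 * j + 5) = x / L ^ 4 * (1 / L ^ (2 * j)) / L := by
      field_simp; ring
    rw [e]
    exact div_le_div_of_nonneg_right (mul_le_mul hBA hsc1 (by positivity) hBA0.le) hL0.le
  have hD : (C₁ + C₂) * x / A ≤ J * BA * sc / (8 * L) := by
    have e : (C₁ + C₂) * x / A = (C₁ + C₂) / L * (x / L ^ (2 * j + 5)) := by
      rw [hAdef, show 2 * (j + 1) + 4 = 2 * j + 5 + 1 by ring, pow_succ]
      field_simp
    rw [e]
    have h1 : (C₁ + C₂) / L ≤ J / 8 := by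
      rw [div_le_iff₀ hL0]; linarith
    have hx5 : 0 ≤ x / L ^ (2 * j + 5) := by positivity
    calc (C₁ + C₂) / L * (x / L ^ (2 * j + 5)) ≤ J / 8 * (x / L ^ (2 * j + 5)) :=
          mul_le_mul_of_nonneg_right h1 hx5
      _ ≤ J / 8 * (BA * sc / L) := mul_le_mul_of_nonneg_left hxA (by positivity)
      _ = J * BA * sc / (8 * L) := by field_simp
  -- (E) `T − Co ≥ J BA sc/(8L) =: M8 > 0` and `(2 − e₁)(T − Co) ≥ M8/2`
  have e : J * BA * sc / (4 * L) - J * BA * sc / (8 * L) = J * BA * sc / (8 * L) := by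
    field_simp; ring
  linarith

set_option maxHeartbeats 400000 in
/-- The real-inequality core of the assembly of Lemma 7, second half: norm factor, singular-series
ratio and `|𝓡_m|` from below. [folklore] -/
private theorem maynard7_core {j : ℕ} {L Ly U m Pw cc sS sS' I1 I2 mP sp N T Co R BA J e₁ κ LHS : ℝ}
    (hL : 4 ≤ L) (hLy1 : 1 ≤ Ly) (hU : 0 < U) (hm : 0 < m) (hPw : 0 < Pw)
    (hcc : 0 < cc) (hsS : 0 < sS) (hsS' : 1 ≤ sS') (hI1 : 0 < I1) (hI2 : 0 < I2) (hmP : 0 < mP)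
    (hsp : 0 < sp) (hN : 1 ≤ N) (hJ : 0 < J) (hκ : 0 < κ) (hBA : 0 < BA)
    (hnorm : m * (L ^ (j + 1) * Ly ^ (j + 1)) * Pw / (U * cc * sS * I1 * I2 * mP) *
        ((2 - e₁) * (T - Co)) ≤ LHS)
    (he₁ : e₁ ≤ 3 / 2)
    (hM8 : J * BA * (sS' * N / (L ^ j * Ly ^ j)) / (8 * L) ≤ T - Co)
    (hR1 : Real.exp (-5) / 2 * (cc * sS * mP) ≤ Ly * sp * Pw * sS' * N)
    (hR : 15 / 32 * (U / m) * sp / L ≤ R) :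
    (1 - κ) * (Real.exp (-5) / 100) * (BA * J) / (L * R * I1 * I2) ≤ LHS := by
  have hL0 : 0 < L := by linarith
  have hLy0 : 0 < Ly := by linarith
  have hBA0 : 0 < BA := hBA
  have hN0 : 0 < N := by linarith
  have hsS'0 : 0 < sS' := by linarith
  set P : ℝ := L ^ j * Ly ^ j with hPdef
  have hP0 : 0 < P := by positivity
  set sc : ℝ := sS' * N / P with hscdef
  have hsc0 : 0 < sc := by positivity
  have hM80 : 0 < J * BA * sc / (8 * L) := by positivity
  have hE : 1 / 2 * (J * BA * sc / (8 * L)) ≤ (2 - e₁) * (T - Co) :=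
    mul_le_mul (by linarith) hM8 hM80.le (by linarith)
  -- (F) `LHS ≥ Fac · M8/2`
  set Fac : ℝ := m * (L ^ (j + 1) * Ly ^ (j + 1)) * Pw / (U * cc * sS * I1 * I2 * mP) with hFacdef
  have hFac0 : 0 < Fac := by positivity
  have hF : Fac * (1 / 2 * (J * BA * sc / (8 * L))) ≤ LHS :=
    le_trans (mul_le_mul_of_nonneg_left hE hFac0.le) hnorm
  -- (G) `Fac · M8/2 = J BA m (Ly Pw sS' N)/(16 U cc sS I1 I2 mP)`
  have hG : Fac * (1 / 2 * (J * BA * sc / (8 * L))) =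
      J * BA * m * (Ly * Pw * sS' * N) / (16 * U * cc * sS * I1 * I2 * mP) := by
    rw [hFacdef, hscdef, hPdef, pow_succ, pow_succ]
    field_simp
    ring
  -- (H) `Ly Pw sS' N ≥ (e^{-5}/2) cc sS mP / sp`
  have hH : J * BA * m * Real.exp (-5) / (32 * U * sp * I1 * I2) ≤
      J * BA * m * (Ly * Pw * sS' * N) / (16 * U * cc * sS * I1 * I2 * mP) := by
    have h1 : Real.exp (-5) / 2 * (cc * sS * mP) / sp ≤ Ly * Pw * sS' * N := by
      rw [div_le_iff₀ hsp]
      calc Real.exp (-5) / 2 * (cc * sS * mP) ≤ Ly * sp * Pw * sS' * N := hR1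
        _ = Ly * Pw * sS' * N * sp := by ring
    have h2 := mul_le_mul_of_nonneg_left h1
      (by positivity : (0 : ℝ) ≤ J * BA * m / (16 * U * cc * sS * I1 * I2 * mP))
    have e1 : J * BA * m / (16 * U * cc * sS * I1 * I2 * mP) * (Real.exp (-5) / 2 * (cc * sS * mP) / sp)
        = J * BA * m * Real.exp (-5) / (32 * U * sp * I1 * I2) := by
      field_simp; ring
    have e2 : J * BA * m / (16 * U * cc * sS * I1 * I2 * mP) * (Ly * Pw * sS' * N) =
        J * BA * m * (Ly * Pw * sS' * N) / (16 * U * cc * sS * I1 * I2 * mP) := by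
      field_simp
    linarith
  -- (I) the target is at most `J BA m e^{-5}/(32 U sp I1 I2)`
  have hpos : 0 ≤ J * BA * m * Real.exp (-5) / (32 * U * sp * I1 * I2) := by positivity
  have hR0 : 0 < R := lt_of_lt_of_le (by positivity) hR
  have hI : (1 - κ) * (Real.exp (-5) / 100) * (BA * J) / (L * R * I1 * I2) ≤
      J * BA * m * Real.exp (-5) / (32 * U * sp * I1 * I2) := by
    have hc0 : 0 ≤ Real.exp (-5) / 100 * (BA * J) := by positivity
    rcases le_or_gt 1 κ with hκ1 | hκ1
    · refine le_trans ?_ hpos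
      apply div_nonpos_of_nonpos_of_nonneg _ (by positivity)
      rw [mul_assoc]
      exact mul_nonpos_of_nonpos_of_nonneg (by linarith) hc0
    · -- `1/(L R) ≤ 32 m/(15 U sp)`
      have h1 : 1 / (L * R) ≤ 32 * m / (15 * U * sp) := by
        rw [div_le_div_iff₀ (by positivity) (by positivity)]
        have h := mul_le_mul_of_nonneg_left hR (by positivity : (0 : ℝ) ≤ 32 * m * L)
        have e : 32 * m * L * (15 / 32 * (U / m) * sp / L) = 15 * U * sp := by
          field_simp
        rw [e] at h
        linarith
      have h2 : (1 - κ) * (Real.exp (-5) / 100) * (BA * J) / (L * R * I1 * I2) ≤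
          (Real.exp (-5) / 100) * (BA * J) / (L * R * I1 * I2) := by
        apply div_le_div_of_nonneg_right _ (by positivity)
        calc (1 - κ) * (Real.exp (-5) / 100) * (BA * J)
            = (1 - κ) * (Real.exp (-5) / 100 * (BA * J)) := by ring
          _ ≤ 1 * (Real.exp (-5) / 100 * (BA * J)) :=
              mul_le_mul_of_nonneg_right (by linarith) hc0
          _ = _ := by ring
      have h3 : (Real.exp (-5) / 100) * (BA * J) / (L * R * I1 * I2) =
          (Real.exp (-5) / 100) * (BA * J) / (I1 * I2) * (1 / (L * R)) := by
        field_simp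
      have h4 : (Real.exp (-5) / 100) * (BA * J) / (I1 * I2) * (1 / (L * R)) ≤
          (Real.exp (-5) / 100) * (BA * J) / (I1 * I2) * (32 * m / (15 * U * sp)) :=
        mul_le_mul_of_nonneg_left h1 (by positivity)
      have h5 : (Real.exp (-5) / 100) * (BA * J) / (I1 * I2) * (32 * m / (15 * U * sp)) ≤
          J * BA * m * Real.exp (-5) / (32 * U * sp * I1 * I2) := by
        rw [div_mul_div_comm, div_le_div_iff₀ (by positivity) (by positivity)]
        have hX : 0 ≤ Real.exp (-5) * BA * J * m * U * sp * I1 * I2 := by positivity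
        have eL : Real.exp (-5) / 100 * (BA * J) * (32 * m) * (32 * U * sp * I1 * I2) =
            1024 / 100 * (Real.exp (-5) * BA * J * m * U * sp * I1 * I2) := by ring
        have eR : J * BA * m * Real.exp (-5) * (I1 * I2 * (15 * U * sp)) =
            15 * (Real.exp (-5) * BA * J * m * U * sp * I1 * I2) := by ring
        rw [eL, eR]
        linarith
      linarith
  -- assemble
  calc (1 - κ) * (Real.exp (-5) / 100) * (BA * J) / (L * R * I1 * I2)
      ≤ J * BA * m * Real.exp (-5) / (32 * U * sp * I1 * I2) := hI
    _ ≤ J * BA * m * (Ly * Pw * sS' * N) / (16 * U * cc * sS * I1 * I2 * mP) := hH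
    _ = Fac * (1 / 2 * (J * BA * sc / (8 * L))) := hG.symm
    _ ≤ LHS := hF


/-! ### Growth facts at a large `x` -/

/-- `e^{24k²/(⌊w⌋+1)} ≤ 3/2` once `⌊w⌋ + 1 ≥ 80k²` (`k ≥ 1`). [folklore] -/
private theorem maynard7_exp_le_three_halves {k : ℕ} (hk : 1 ≤ k) {W : ℝ} (hW0 : 0 < W)
    (hW : 80 * (k : ℝ) ^ 2 ≤ W) : Real.exp (24 * (k : ℝ) ^ 2 / W) ≤ 3 / 2 := by
  have hk2 : (1 : ℝ) ≤ (k : ℝ) ^ 2 := by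
    have : (1 : ℝ) ≤ k := by exact_mod_cast hk
    nlinarith
  have ht : 24 * (k : ℝ) ^ 2 / W ≤ 3 / 10 := by
    rw [div_le_iff₀ hW0]; nlinarith
  have h1 : Real.exp (24 * (k : ℝ) ^ 2 / W) ≤ Real.exp (3 / 10) := Real.exp_le_exp.2 ht
  have h2 : Real.exp (3 / 10) ^ 2 ≤ 2 := by
    rw [← Real.exp_nat_mul]
    have : ((2 : ℕ) : ℝ) * (3 / 10 : ℝ) ≤ Real.log 2 := by
      have := Real.log_two_gt_d9; push_cast; linarith
    calc Real.exp (((2 : ℕ) : ℝ) * (3 / 10)) ≤ Real.exp (Real.log 2) := Real.exp_le_exp.2 this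
      _ = 2 := Real.exp_log (by norm_num)
  nlinarith [Real.exp_pos (3 / 10), Real.exp_pos (24 * (k : ℝ) ^ 2 / W)]

/-- The growth facts at a large `x` used by the assembly (`0 < ε ≤ 1/2`, `K, δ > 0`, `M` real,
`k ≥ 1`): `4 ≤ log x`, `4 ≤ log₂ x ≤ log x`, `0 < z`, `0 < U ≤ x log² x`, `U/(z log₂² x) ≤ x`,
`K e^{−√log₂ x} ≤ 1/2`, `8/δ ≤ log x`, `M ≤ log x`, `1 ≤ log y ≤ log x`, `log² x ≤ x`,
`e^{24k²/(⌊w⌋+1)} ≤ 3/2`. [cite: Maynard2016LargeGaps, §2 display (2.1)] -/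
private theorem maynard7_facts {C_U : ℝ} (hCU : 0 < C_U) {K : ℝ} (hK : 0 < K) (δ M : ℝ)
    {k : ℕ} (hk : 1 ≤ k) {ε : ℝ} (hε0 : 0 < ε) (hε : ε ≤ 1 / 2) :
    ∀ᶠ x : ℕ in atTop,
      4 ≤ Real.log x ∧ 4 ≤ Real.log (Real.log x) ∧ Real.log (Real.log x) ≤ Real.log x ∧
      0 < z x ∧ 0 < U C_U ε x ∧ U C_U ε x ≤ (x : ℝ) * Real.log x ^ 2 ∧
      U C_U ε x / (z x * Real.log (Real.log x) ^ 2) ≤ x ∧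
      K * Real.exp (-(Real.log (Real.log x)) ^ ((1 : ℝ) / 2)) ≤ 1 / 2 ∧ 8 / δ ≤ Real.log x ∧
      M ≤ Real.log x ∧ 1 ≤ Real.log (y ε x) ∧ Real.log (y ε x) ≤ Real.log x ∧
      Real.log x ^ 2 ≤ x ∧ Real.exp (24 * (k : ℝ) ^ 2 / (⌊wFun x⌋₊ + 1)) ≤ 3 / 2 := by
  have hT₁ : Tendsto (fun X : ℝ => Real.log X) atTop atTop := Real.tendsto_log_atTop
  have hT₂ : Tendsto (fun X : ℝ => Real.log (Real.log X)) atTop atTop :=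
    Real.tendsto_log_atTop.comp hT₁
  have hT₃ : Tendsto (fun X : ℝ => Real.log (Real.log (Real.log X))) atTop atTop :=
    Real.tendsto_log_atTop.comp hT₂
  have hreal : ∀ᶠ X : ℝ in atTop, 4 ≤ Real.log (Real.log X) ∧
      2 ≤ Real.log (Real.log (Real.log X)) ∧ C_U ≤ Real.log X ∧
      Real.log (2 * K) ^ 2 ≤ Real.log (Real.log X) ∧ 8 / δ ≤ Real.log X ∧ M ≤ Real.log X := by
    filter_upwards [hT₂.eventually_ge_atTop 4, hT₃.eventually_ge_atTop 2,
      hT₁.eventually_ge_atTop C_U, hT₂.eventually_ge_atTop (Real.log (2 * K) ^ 2),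
      hT₁.eventually_ge_atTop (8 / δ), hT₁.eventually_ge_atTop M] with X h1 h2 h3 h4 h5 h6
    exact ⟨h1, h2, h3, h4, h5, h6⟩
  filter_upwards [tendsto_natCast_atTop_atTop.eventually hreal, eventually_iteratedLogs,
    eventually_gt_atTop 0, eventually_U_pos hCU hε0.le hε, eventually_le_wFun (80 * (k : ℝ) ^ 2)]
    with x hx hlogs hx0 hU hw80
  obtain ⟨hL₂4, hL₃2, hCL, hKL, hδL, hML⟩ := hx
  obtain ⟨hL4, -, -, hL₃L₂, hL₂L, -, hsq⟩ := hlogs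
  set L := Real.log x with hLdef
  set L₂ := Real.log (Real.log x) with hL₂def
  set L₃ := Real.log (Real.log (Real.log x)) with hL₃def
  have hx0' : (0 : ℝ) < x := by exact_mod_cast hx0
  have hL0 : 0 < L := by linarith
  have hL₂0 : 0 < L₂ := by linarith
  have hz0 : 0 < z x := by unfold z; rw [← hL₂def]; positivity
  -- `log y`
  have hlyL : Real.log (y ε x) ≤ L := by
    rw [log_y, ← hLdef, ← hL₂def, ← hL₃def]
    have h1 : L * L₃ / L₂ ≤ L := by
      rw [div_le_iff₀ hL₂0]; nlinarith
    have h2 : 0 ≤ L * L₃ / L₂ := by positivity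
    nlinarith
  have hly1 : 1 ≤ Real.log (y ε x) := by
    have := half_log₃_le_log_y hε hL₂0 (by linarith) (by linarith : (0 : ℝ) ≤ L₃)
    rw [← hL₃def] at this; linarith
  -- `U ≤ x log² x`
  have hUx : U C_U ε x ≤ (x : ℝ) * L ^ 2 := by
    have h1 : U C_U ε x ≤ C_U * (x * Real.log (y ε x)) := by
      unfold U; rw [← hL₂def]
      apply mul_le_mul_of_nonneg_left _ hCU.le
      exact div_le_self (by positivity) (by linarith)
    have h2 : C_U * (x * Real.log (y ε x)) ≤ L * (x * L) :=
      mul_le_mul hCL (mul_le_mul_of_nonneg_left hlyL hx0'.le) (by positivity) hL0.le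
    nlinarith
  -- `U/(z log₂²) ≤ x`
  have hUz : U C_U ε x / (z x * L₂ ^ 2) ≤ x := by
    rw [div_le_iff₀ (by positivity)]
    have hz : z x * L₂ ^ 2 = x * L₂ := by
      unfold z; rw [← hL₂def]; field_simp
    rw [hz]
    have h2 : (x : ℝ) * L ^ 2 ≤ x * (x * L₂) := by
      apply mul_le_mul_of_nonneg_left _ hx0'.le
      nlinarith
    linarith
  have hW : Real.exp (24 * (k : ℝ) ^ 2 / (⌊wFun x⌋₊ + 1)) ≤ 3 / 2 :=
    maynard7_exp_le_three_halves hk (by positivity)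
      (le_trans hw80 (le_of_lt (Nat.lt_floor_add_one _)))
  exact ⟨hL4, hL₂4, by linarith, hz0, hU, hUx, hUz, maynard7_K_mul_exp_neg_sqrt_le hK hKL, hδL,
    hML, hly1, hlyL, hsq, hW⟩

/-! ### The assembly -/

set_option maxHeartbeats 1600000 in
/-- **Lemma 7 (per-tuple form) from the two engine facts.** With the absolute constant
`c = e^{−5}/100`: norm factor (`lemma7_normHalf`), class moment (`Lemma7ClassMoment`),
error half (`lemma7_errorHalf`), main term (`Lemma7MainLower`), primes of `𝓘_m`
(`eventually_card_intervalPrimes_ge`), `|𝓡_m|` by Lemma 3 (`lemma3_holds`) and the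
singular-series ratio (`eventually_lemma7_singRatio`).
[cite: Maynard2016LargeGaps, Lemma 7 (proof, displays (6.26)–(6.34))] -/
theorem lemma7Tuple_of_parts (h1 : Lemma7MainLower) (h2 : Lemma7ClassMoment) : Lemma7Tuple := by
  intro C_U hCU
  have hεhalf : ∀ᶠ ε : ℝ in 𝓝[>] 0, ε ≤ 1 / 2 :=
    eventually_nhdsWithin_of_eventually_nhds (eventually_le_nhds (by norm_num : (0 : ℝ) < 1 / 2))
  have hεpos : ∀ᶠ ε : ℝ in 𝓝[>] 0, 0 < ε := eventually_mem_nhdsWithin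
  filter_upwards [lemma3_holds, eventually_card_Rm_ge hCU, hεhalf, hεpos] with ε h3ε hRε hε hε0
  obtain ⟨K, hK, h3x⟩ := h3ε
  refine ⟨Real.exp (-5) / 100, by positivity, ?_⟩
  intro k hk J cj Fd G hD hI1 hI2 δ hδ κ hκ
  -- one `i` at a time (`Fin k` is finite)
  suffices hi : ∀ i : Fin k, ∀ᶠ x : ℕ in atTop, ∀ m : ℕ, 1 ≤ m → Even m →
      (m : ℝ) < U C_U ε x / (z x * Real.log (Real.log x) ^ 2) →
        ∀ A B : ℝ, (x : ℝ) / 2 ≤ A → B ≤ x → δ * (Rm C_U ε x m).card * Real.log x ≤ B - A →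
          ∀ p₀ ∈ Rm C_U ε x m, (hTuple k x i : ℝ) * x < p₀ →
            (1 - κ) * (Real.exp (-5) / 100) * ((B - A) * J1 cj Fd i * J2 k G) /
                (Real.log x * (Rm C_U ε x m).card * I1 cj Fd * I2 k G) ≤
              ∑ q ∈ intervalPrimes A B,
                divSum cj Fd G ε x m q (p₀ - hTuple k x i * q) ^ 2 / normMain cj Fd G C_U ε x m q by
    filter_upwards [Filter.eventually_all.2 hi] with x hx m hm hmev hmU A B hA hB hAB p₀ hp₀ hwin i
    exact hx i m hm hmev hmU A B hA hB hAB p₀ hp₀ (hwin i).1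
  intro i
  have hk0 : 0 < k := by omega
  have hk1 : 1 ≤ k := hk0
  have hJv0 : 0 ≤ J1 cj Fd i * J2 k G := mul_nonneg (J1_nonneg cj Fd i) (J2_nonneg k G)
  rcases hJv0.eq_or_lt with hJ0 | hJpos
  · -- `J₁^{(i)} J₂ = 0`: the claimed lower bound is `0`
    filter_upwards [maynard7_facts hCU hK δ 0 hk1 hε0 hε] with x hfx m hm hmev hmU A B hA hB hAB
      p₀ hp₀ hwin
    obtain ⟨hL4, -, -, -, hU, -, -, -, -, -, hLy1, -, -, -⟩ := hfx
    have hnum : (B - A) * J1 cj Fd i * J2 k G = 0 := by rw [mul_assoc, ← hJ0, mul_zero]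
    rw [hnum, mul_zero, zero_div]
    exact Finset.sum_nonneg fun q _ => div_nonneg (sq_nonneg _)
      (normMain_nonneg hU.le hI1.le hI2.le (by linarith) (by linarith))
  -- `J := J₁^{(i)} J₂ > 0`; take `η = J/4`, error exponent `2k+4`
  have hη : 0 < J1 cj Fd i * J2 k G / 4 := by positivity
  have hM1 := h1 k J cj Fd G hk hD ε hε0 hε _ hη
  obtain ⟨C₂, hM2⟩ := h2 k J cj Fd G hk hD ε hε0 hε ((2 * k + 4 : ℕ) : ℝ) (by positivity) _ hη
  obtain ⟨C₁, hE⟩ := lemma7_errorHalf hD C_U hε0.le hε (A := ((2 * k + 4 : ℕ) : ℝ))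
    (by positivity)
  have hNf := lemma7_normHalf cj Fd G hCU hε0.le hε hk0
  have hSR := eventually_lemma7_singRatio (ε := ε) hε
  have hIP := eventually_card_intervalPrimes_ge 4 (by norm_num : (0 : ℝ) < 1 / 2)
  filter_upwards [hM1, hM2, hE, hNf, hSR, hIP, h3x, hRε,
    maynard7_facts hCU hK δ (8 * (C₁ + C₂) / (J1 cj Fd i * J2 k G)) hk1 hε0 hε,
    eventually_gt_atTop 0] with x hM1x hM2x hEx hNx hSRx hIPx h3xx hRx hfx hx0 m hm hmev hmU A B
    hA hB hAB p₀ hp₀ hwin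
  obtain ⟨hL4, hL₂4, hL₂L, hz0, hU, hUx, hUz, hKe, hδL, hCJL, hLy1, hlyL, hsq, he₁⟩ := hfx
  set L := Real.log x with hLdef
  set L₂ := Real.log (Real.log x) with hL₂def
  set Ly := Real.log (y ε x) with hLydef
  have hx0' : (0 : ℝ) < x := by exact_mod_cast hx0
  have hL0 : 0 < L := by linarith
  have hm0 : (0 : ℝ) < m := by exact_mod_cast hm
  have hmx : m ≤ x := by
    have : (m : ℝ) ≤ x := by linarith
    exact_mod_cast this
  -- facts about `p₀`
  obtain ⟨hp, hxp, hcop, -⟩ := facts_of_mem_Rm_of_window hp₀ hwin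
  obtain ⟨-, -, -, hp₀le⟩ := prime_and_coprime_of_mem_Rm hp₀
  have hp2 : (p₀ : ℝ) ≤ (x : ℝ) ^ 2 := by
    have h1 : (p₀ : ℝ) ≤ ⌊U C_U ε x / m⌋₊ := by exact_mod_cast hp₀le
    have h2 : (⌊U C_U ε x / m⌋₊ : ℝ) ≤ U C_U ε x / m :=
      Nat.floor_le (div_nonneg hU.le hm0.le)
    have h3 : U C_U ε x / m ≤ U C_U ε x := div_le_self hU.le (by exact_mod_cast hm)
    have h4 : (x : ℝ) * L ^ 2 ≤ (x : ℝ) ^ 2 := by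
      rw [sq (x : ℝ)]; exact mul_le_mul_of_nonneg_left hsq hx0'.le
    linarith
  -- `B − A ≥ x/log⁴ x` (from `B − A ≥ δ |𝓡_m| log x`, `|𝓡_m| ≥ x/(8 log⁴ x)`, `δ log x ≥ 8`)
  have hRge := hRx m hm hmev hmU
  have hBA : (x : ℝ) / L ^ 4 ≤ B - A := by
    refine le_trans ?_ hAB
    have h8 : 1 ≤ δ * L / 8 := by
      rw [le_div_iff₀ (by norm_num : (0 : ℝ) < 8)]
      have := (div_le_iff₀ hδ).1 hδL
      linarith
    calc (x : ℝ) / L ^ 4 ≤ (δ * L / 8) * ((x : ℝ) / L ^ 4) :=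
          le_mul_of_one_le_left (by positivity) h8
      _ = δ * ((x : ℝ) / (8 * L ^ 4)) * L := by field_simp
      _ ≤ δ * ((Rm C_U ε x m).card : ℝ) * L := by
          have := mul_le_mul_of_nonneg_left hRge hδ.le
          exact mul_le_mul_of_nonneg_right this hL0.le
  have hBA0 : 0 < B - A := lt_of_lt_of_le (by positivity) hBA
  have hAB' : A ≤ B := by linarith
  -- `|𝓡_m| ≥ (15/32)(U/m) 𝔖_y(m)/log x` (Lemma 3, lower half, `V = U/m ≥ z log₂² x`)
  have hsp0 : 0 < singProd ε x m :=
    lt_of_lt_of_le (oddPrimeProd_pos _) (oddPrimeProd_le_singProd ε x hmev)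
  have hR : 15 / 32 * (U C_U ε x / m) * singProd ε x m / L ≤ ((Rm C_U ε x m).card : ℝ) := by
    set V := U C_U ε x / m with hV
    have hVge : z x * L₂ ^ 2 ≤ V := by
      rw [hV, le_div_iff₀ hm0]
      rw [lt_div_iff₀ (by positivity)] at hmU
      linarith
    have hL₂sq : 16 ≤ L₂ ^ 2 := by
      have := mul_self_le_mul_self (by norm_num : (0 : ℝ) ≤ 4) hL₂4
      rw [sq]; linarith
    have h16 : 16 * z x ≤ V := by
      have : z x * 16 ≤ z x * L₂ ^ 2 := mul_le_mul_of_nonneg_left hL₂sq hz0.le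
      linarith
    have hV1 : z x + z x / L ≤ V := by
      have : z x / L ≤ z x := div_le_self hz0.le (by linarith)
      linarith
    have hV2 : V ≤ (x : ℝ) * L ^ 2 := by
      rw [hV]; exact (div_le_self hU.le (by exact_mod_cast hm)).trans hUx
    have h3 := h3xx V hV1 hV2 m hm hmx
    set main := (V - z x) / L * singProd ε x m with hmain
    have hmain0 : 0 ≤ main := by
      rw [hmain]; exact mul_nonneg (div_nonneg (by linarith) hL0.le) hsp0.le
    have hcard : main / 2 ≤ ((sievedPrimes ε x V m).card : ℝ) := by
      have h1 := (abs_le.1 h3).1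
      have h2 : K * Real.exp (-(Real.log (Real.log x)) ^ ((1 : ℝ) / 2)) * main ≤
          (1 / 2) * main := mul_le_mul_of_nonneg_right hKe hmain0
      linarith
    have hmainge : 15 / 16 * V * singProd ε x m / L ≤ main := by
      rw [hmain]
      have h1 : 15 / 16 * V ≤ V - z x := by linarith
      have h2 : 15 / 16 * V * singProd ε x m / L = (15 / 16 * V) / L * singProd ε x m := by ring
      rw [h2]
      exact mul_le_mul_of_nonneg_right (div_le_div_of_nonneg_right h1 hL0.le) hsp0.le
    have hRm : Rm C_U ε x m = sievedPrimes ε x V m := by rw [Rm]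
    rw [hRm]
    have e : 15 / 32 * V * singProd ε x m / L = (15 / 16 * V * singProd ε x m / L) / 2 := by ring
    rw [e]
    linarith
  -- instantiate the four inputs
  have hT := hEx m hm A B hA hAB' hB p₀ hp₀ i hwin
  have hS := hM1x m hm hmx p₀ hp hxp hp2 hcop i
  have hCo := hM2x m hm hmx A B hA hAB' hB p₀ hp hxp hp2 hcop i hwin
  have hnorm := hNx m hmev hI1 hI2 A B hA hAB' p₀ i
  have hnI := hIPx A B hA hB hBA
  have hPw0 : (0 : ℝ) < Pw x := by exact_mod_cast Nat.pos_of_ne_zero (Pw_ne_zero x)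
  have hR1 := le_trans (hSRx k hk1 m hmev) (mul_le_mul_of_nonneg_left
    (prod_mid_dvd_le_nuProd7 k ε x hm p₀ i)
      (mul_nonneg (mul_nonneg (mul_nonneg (by linarith) hsp0.le) hPw0.le)
        (singSmall_pos (k - 1) x).le))
  -- exponents: `k = (k-1) + 1`, real exponent `2k+4` as a natural power
  have hkj : k = (k - 1) + 1 := (Nat.sub_add_cancel hk1).symm
  have hA : Real.log x ^ ((2 * k + 4 : ℕ) : ℝ) = L ^ (2 * (k - 1 + 1) + 4) := by
    rw [Real.rpow_natCast, ← hkj]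
  rw [hA] at hT hCo
  have hT' : ((intervalPrimes A B).card : ℝ) * solvSum cj Fd G ε x m p₀ i -
      C₁ * x / L ^ (2 * (k - 1 + 1) + 4) ≤
        ∑ q ∈ intervalPrimes A B, divSum cj Fd G ε x m q (p₀ - hTuple k x i * q) ^ 2 := by
    have := (abs_le.1 hT).1; linarith
  have hS' : (J1 cj Fd i * J2 k G - J1 cj Fd i * J2 k G / 4) *
      (singSmall (k - 1) x * nuProd7 k x m p₀ i) ≤
        L ^ (k - 1) * Ly ^ (k - 1) * solvSum cj Fd G ε x m p₀ i := hS
  have hCo' : classCorr cj Fd G ε x m p₀ i A B ≤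
      J1 cj Fd i * J2 k G / 4 * ((intervalPrimes A B).card : ℝ) *
          (singSmall (k - 1) x * nuProd7 k x m p₀ i) / (L ^ (k - 1) * Ly ^ (k - 1)) +
        C₂ * x / L ^ (2 * (k - 1 + 1) + 4) := hCo
  have hnorm' : (m : ℝ) * (L ^ (k - 1 + 1) * Ly ^ (k - 1 + 1)) * Pw x /
      (U C_U ε x * classCount x m * singSmall k x * I1 cj Fd * I2 k G * mPart k ε x m) *
        ((2 - Real.exp (24 * (k : ℝ) ^ 2 / (⌊wFun x⌋₊ + 1))) *
          (∑ q ∈ intervalPrimes A B, divSum cj Fd G ε x m q (p₀ - hTuple k x i * q) ^ 2 -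
            classCorr cj Fd G ε x m p₀ i A B)) ≤
        ∑ q ∈ intervalPrimes A B,
          divSum cj Fd G ε x m q (p₀ - hTuple k x i * q) ^ 2 / normMain cj Fd G C_U ε x m q := by
    rw [← hkj]; exact hnorm
  -- the algebra
  have hCJL' : 8 * (C₁ + C₂) ≤ J1 cj Fd i * J2 k G * L := by
    have := (div_le_iff₀ hJpos).1 hCJL; linarith
  have hM8 := maynard7_core_main (j := k - 1) hL4 hLy1 hlyL (one_le_singSmall7 (k - 1) x)
    (one_le_nuProd7 k x m p₀ i) hJpos hx0' hBA hT' hS' hCo' hnI hCJL'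
  have hfinal := maynard7_core (j := k - 1) (κ := κ) hL4 hLy1 hU hm0 hPw0
    (classCount_pos_of_even hmev) (singSmall_pos k x) (one_le_singSmall7 (k - 1) x) hI1 hI2
    (mPart_pos k ε x m) hsp0 (one_le_nuProd7 k x m p₀ i) hJpos hκ hBA0 hnorm' he₁ hM8 hR1 hR
  -- match the shape of the target
  have e : (1 - κ) * (Real.exp (-5) / 100) * ((B - A) * J1 cj Fd i * J2 k G) /
      (Real.log x * (Rm C_U ε x m).card * I1 cj Fd * I2 k G) =
      (1 - κ) * (Real.exp (-5) / 100) * ((B - A) * (J1 cj Fd i * J2 k G)) /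
        (L * (Rm C_U ε x m).card * I1 cj Fd * I2 k G) := by
    rw [hLdef]; ring
  rw [e]
  exact hfinal

end Maynard2016

end Literature.NumberTheory.Sieve
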